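import Literature.NumberTheory.EllipticCurves.QuadraticTwistKroneckerRootNumberProofs
import Literature.NumberTheory.EllipticCurves.HeegnerHypothesisKroneckerProofs
import Literature.NumberTheory.EllipticCurves.RootNumberSmulProofs
import Summits.BirchSwinnertonDyer.Rank1Residual.Supersingular.TamagawaParitySquare
import HarnessLib

/-!
# Cell «bsd-uniform», track U2 (2-adic assembly), ROUTE B — layer 1:
# the parity / root-number bookkeeping at `2` for the `a_q`-odd genus twists `E^{(M*)}`, `E^{(M* d_K)}`

HONEST FRAMING (cell «bsd-uniform», HOME `run/shared/lean/pub/bsd-uniform/`, seat u2-p2). What this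
file IS: the sign/root-number layer of the «a_q-odd combination at 2» (route T4′ of the «bsd-p2»
sub-lane, `p2/idea-2/T4-PROOF.md` Remark 4.2/4.2′; Kriz–Li 2019 Lemma 5.1 / Cor. 5.2 for their split
primes), PROVED as elementary Jacobi-symbol algebra plus the tree's root-number-of-a-twist theorem,
against two NAMED TYPED HYPOTHESES on the minimal discriminant `Δ` of `E` that isolate exactly the
local-type input:
* `hsq : IsSquare (N · |Δ|)` — "every local Tamagawa number `c_ℓ(E)` is odd and `E(ℚ)[2] = 0`" forces,
  prime by prime, an odd number `m_ℓ` of geometric components (Tate's table: the `c_ℓ`-odd Kodaira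
  types are `I_n` (`n` odd), `II`, `IV`, `I₀*`, `IV*`, `II*`), hence `f_ℓ ≡ v_ℓ(Δ_min) (mod 2)` by
  Ogg–Saito `f_ℓ = v_ℓ(Δ) + 1 − m_ℓ`, i.e. `N · |Δ_min|` is a perfect square (T4-PROOF Remark 4.2′);
  this file does NOT derive `hsq` from the reduction types — it is the typed interface to them (the
  lit seat's as-printed Tate/Ogg–Saito statements are the intended dischargers), and an `E` for
  which it fails (some `c_ℓ(E)` even) is OUTSIDE this layer: RESIDUE, named in HOME/RESIDUE.md;
* `hres : J(Δ | q) = 1` for the primes `q ∣ M` — "`a_q(E)` odd ⇒ `Frob_q` is a `3`-cycle on `E[2]`,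
  hence fixes the resolvent `√Δ ∈ ℚ(E[2])`" (Serre 1972; Kriz–Li 2019, proof of Lemma 5.1:
  `ℚ(√Δ(E)) ⊆ ℚ(E[2])`); again a typed interface, per prime of `M`.
What this file is NOT: it proves no case of BSD, asserts no arithmetic fact about Heegner points,
and moves no mark of the residual map; every deep input is a binder or a tree theorem
(`rootNumber_quadraticTwist_of_emod_four_eq_one`, conditional on Modularity `exists_isNewformOf`).

## Contents (all `theorem`s, no `def`, no named fact introduced)

* §1 Jacobi-symbol lemmas and the **SIGN LAW** `sign_mul_jacobiSym_conductor_eq`: for `d ≡ 1 (mod 4)`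
  (`d = M* = ∏ q*`) whose prime factors `q` satisfy `q ∤ NΔ` and `J(Δ | q) = 1`, and `N|Δ|` a square,
  `χ_d(−N) = sign d · J(N | |d|) = (−1)^{h_∞(d)}` with `h_∞(d) = [Δ > 0 ∧ d < 0]`
  (T4-PROOF Remark 4.2′: "`χ_{M*}(−N) = sgn(M*)` if `Δ > 0` and `= +1` if `Δ < 0`").
* §2 The Heegner side in the same currency: `J(−1 | |D|) · J(N | |D|) = −1` for an odd imaginary
  quadratic discriminant `D` in which every `p ∣ N` splits (Kronecker form, and from the tree's
  `SatisfiesHeegnerHypothesis` via `satisfiesHeegnerHypothesis_iff_kronecker`).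
* §3 `w(E^{(d)}) = (−1)^{h_∞(d)} w(E)` under the sign-law hypotheses (the root number of the member
  `E^{(M*)}`; the product over the genus pair and the dichotomy live in the sibling file
  `RouteBRankDichotomy`).
* §4 The rank TABLE read off a Kriz–Li-Thm-3.3-shaped dichotomy (the output of the sibling file
  `RouteBRankDichotomy.analyticRank_genusPair_dichotomy`, taken here as the binder `hdich`):
  `r(E^{(d)}) = r(E)` if `h_∞(d) = 0`, `= 1 − r(E)` if `h_∞(d) = 1` (Kriz–Li 2019 Example 6.1's
  display for `37a1`: `Δ = 37 > 0`, so rank `1` iff `d > 0`).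
* §5 `Δ := Δ_min` (`minimalDiscriminantInt` of a globally minimal model) and `hsq` DISCHARGED on the
  class `Tam(E)` odd by the tree's Tamagawa-parity square lemma
  (`Rank1Residual/Supersingular/TamagawaParitySquare`: `c_v` odd ⇒ `m_v` odd ⇒ Ogg ⇒ square) — so on
  (H-c) the only remaining typed ingredient of the sign law is the resolvent hypothesis `hres`.

References: Kriz–Li, FMS 7 (2019) e15 = arXiv:1606.03172, Lemma 5.1, Cor. 5.2, Ex. 6.1 [KrizLi2019];
Murty–Murty 1997 Ch. 6 §1 [MurtyMurty1997]; Serre 1972 [Serre1972]; Ogg 1967 / Saito 1988 [Ogg1967]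
[Saito1988]; Tate 1975 [Tate1975]; Darmon 2004 Hyp. 3.9 [Darmon2004]; `p2/idea-2/T4-PROOF.md` v1.9b.
-/

noncomputable section

open scoped Classical NumberTheorySymbols

open WeierstrassCurve Literature.NumberTheory.EllipticCurves
  Literature.NumberTheory.EllipticCurves.ModularForms

namespace Summit.BirchSwinnertonDyer.Uniform.U2

/-! ## §1 Jacobi-symbol lemmas and the sign law -/

/-- If `J(a | q) = 1` for every prime `q ∣ b` (`b ≠ 0`), then `J(a | b) = 1` (the Jacobi symbol is
the product of the Legendre symbols over the prime factorisation of `b`). [folklore] -/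
theorem jacobiSym_eq_one_of_forall_prime {a : ℤ} {b : ℕ} (hb : b ≠ 0)
    (h : ∀ q : ℕ, q.Prime → q ∣ b → J(a | q) = 1) : J(a | b) = 1 := by
  rw [← Nat.prod_primeFactorsList hb, jacobiSym.list_prod_right
    (fun n hn => (Nat.prime_of_mem_primeFactorsList hn).ne_zero)]
  refine List.prod_eq_one (fun x hx => ?_)
  obtain ⟨q, hq, rfl⟩ := List.mem_map.1 hx
  exact h q (Nat.prime_of_mem_primeFactorsList hq) (Nat.dvd_of_mem_primeFactorsList hq)

/-- `J(s | b)² = 1` for a sign `s = ±1`. [folklore] -/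
theorem jacobiSym_mul_self_of_sign {s : ℤ} (hs : s = 1 ∨ s = -1) (b : ℕ) :
    J(s | b) * J(s | b) = 1 := by
  have hg : s.gcd b = 1 := by
    rcases hs with rfl | rfl <;> simp [Int.gcd]
  have := jacobiSym.sq_one hg
  rw [sq] at this
  exact this

/-- The sign of a non-zero integer is `±1`. [folklore] -/
theorem sign_eq_one_or_eq_neg_one (Δ : ℤ) (hΔ : Δ ≠ 0) : Int.sign Δ = 1 ∨ Int.sign Δ = -1 := by
  rcases lt_or_gt_of_ne hΔ with h | h
  · exact Or.inr (Int.sign_eq_neg_one_of_neg h)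
  · exact Or.inl (Int.sign_eq_one_of_pos h)

/-- **Sign law, one prime.** If `N · |Δ|` is a square, `q` is a prime with `q ∤ NΔ`, and
`J(Δ | q) = 1` (the resolvent hypothesis: `Frob_q` of order `3` on `E[2]` fixes `√Δ`), then
`J(N | q) = J(sign Δ | q)`, i.e. `(N/q) = 1` if `Δ > 0` and `(N/q) = (−1/q)` if `Δ < 0` — equivalently
`(−N/q) = (−sign Δ / q)` (T4-PROOF Remark 4.2′). [cite: KrizLi2019, Lemma 5.1 and Cor. 5.2 (the sign bookkeeping, split primes)] -/
theorem jacobiSym_conductor_eq_jacobiSym_sign {N : ℕ} {Δ : ℤ} {q : ℕ} [Fact q.Prime]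
    (hsq : IsSquare ((N : ℤ) * Δ.natAbs)) (hq : ¬ (q : ℤ) ∣ (N : ℤ) * Δ)
    (hres : J(Δ | q) = 1) : J((N : ℤ) | q) = J(Int.sign Δ | q) := by
  have hΔ0 : Δ ≠ 0 := by
    rintro rfl
    exact hq (by simp)
  obtain ⟨k, hk⟩ := hsq
  have hΔ : (Δ.natAbs : ℤ) = Int.sign Δ * Δ := (Int.sign_mul_self_eq_natAbs Δ).symm
  -- `q ∤ k`, since `k² = N·|Δ|` and `q ∤ N·Δ`
  have hqk : ¬ (q : ℤ) ∣ k := by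
    intro hdvd
    apply hq
    have h1 : (q : ℤ) ∣ (N : ℤ) * Δ.natAbs := by rw [hk]; exact Dvd.dvd.mul_right hdvd k
    rw [hΔ, ← mul_assoc, mul_comm (N : ℤ), mul_assoc] at h1
    rcases sign_eq_one_or_eq_neg_one Δ hΔ0 with h | h
    · simpa [h] using h1
    · rw [h] at h1
      have : (q : ℤ) ∣ -((N : ℤ) * Δ) := by simpa using h1
      exact (dvd_neg).1 this
  have hgcd : k.gcd q = 1 := by
    have : Nat.Coprime q k.natAbs :=
      (Nat.Prime.coprime_iff_not_dvd (Fact.out : q.Prime)).2 (fun h => hqk (Int.natCast_dvd.2 h))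
    simpa [Int.gcd, Nat.coprime_comm] using this
  have h1 : J((N : ℤ) * Δ.natAbs | q) = 1 := by
    rw [hk, ← sq, jacobiSym.sq_one' hgcd]
  rw [hΔ, jacobiSym.mul_left, jacobiSym.mul_left, hres, mul_one] at h1
  have hs := jacobiSym_mul_self_of_sign (sign_eq_one_or_eq_neg_one Δ hΔ0) q
  calc J((N : ℤ) | q) = (J((N : ℤ) | q) * J(Int.sign Δ | q)) * J(Int.sign Δ | q) := by
        rw [mul_assoc, hs, mul_one]
    _ = J(Int.sign Δ | q) := by rw [h1, one_mul]

/-- `(−1 / |d|) = χ₄(|d|) = sign d` for `d ≡ 1 (mod 4)` (so `|d| ≡ 1 (mod 4)` iff `d > 0`).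
[folklore] -/
theorem jacobiSym_neg_one_natAbs_eq_sign {d : ℤ} (hd4 : d % 4 = 1) :
    J(-1 | d.natAbs) = Int.sign d := by
  have hd0 : d ≠ 0 := by rintro rfl; norm_num at hd4
  have hodd : Odd d.natAbs := Int.natAbs_odd.2 (Int.odd_iff.2 (by omega))
  rw [jacobiSym.at_neg_one hodd]
  rcases lt_or_gt_of_ne hd0 with h | h
  · rw [Int.sign_eq_neg_one_of_neg h]
    have h3 : d.natAbs % 4 = 3 := by omega
    exact ZMod.χ₄_nat_three_mod_four h3
  · rw [Int.sign_eq_one_of_pos h]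
    have h1 : d.natAbs % 4 = 1 := by omega
    exact ZMod.χ₄_nat_one_mod_four h1

/-- **SIGN LAW (route B, layer 1).** Let `N ≥ 1` (the conductor), `Δ ≠ 0` (the minimal
discriminant) and `d ≡ 1 (mod 4)` (the twisting parameter `M* = ∏ q*`). Assume the two typed
ingredients: `N · |Δ|` is a square (all `c_ℓ(E)` odd, via Tate's table and Ogg–Saito), and every prime
`q ∣ d` has `q ∤ NΔ` and `J(Δ | q) = 1` (`a_q(E)` odd, via the resolvent `√Δ ∈ ℚ(E[2])`). Then
`χ_d(−N) = sign d · J(N | |d|)` equals `sign d` if `Δ > 0` and `1` if `Δ < 0`: the quadratic character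
of `ℚ(√d)` at `−N` is `(−1)^{h_∞(d)}`, `h_∞(d) = [Δ > 0 ∧ d < 0]` (T4-PROOF Remark 4.2′; for primes
split in a Heegner field this is Kriz–Li 2019 Cor. 5.2 (2) ⟺ (3)).
[cite: KrizLi2019, Cor. 5.2 ((2) ⟺ (3))] -/
theorem sign_mul_jacobiSym_conductor_eq {N : ℕ} {Δ d : ℤ} (hΔ : Δ ≠ 0) (hd4 : d % 4 = 1)
    (hsq : IsSquare ((N : ℤ) * Δ.natAbs))
    (hprimes : ∀ q : ℕ, q.Prime → q ∣ d.natAbs → ¬ (q : ℤ) ∣ (N : ℤ) * Δ ∧ J(Δ | q) = 1) :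
    Int.sign d * J((N : ℤ) | d.natAbs) = if 0 < Δ then Int.sign d else 1 := by
  have hd0 : d ≠ 0 := by rintro rfl; norm_num at hd4
  have hdabs : d.natAbs ≠ 0 := Int.natAbs_ne_zero.2 hd0
  have hs : Int.sign Δ = 1 ∨ Int.sign Δ = -1 := sign_eq_one_or_eq_neg_one Δ hΔ
  -- `J(N·s | |d|) = 1`, prime by prime
  have hNs : J((N : ℤ) * Int.sign Δ | d.natAbs) = 1 := by
    refine jacobiSym_eq_one_of_forall_prime hdabs (fun q hq hqd => ?_)
    haveI : Fact q.Prime := ⟨hq⟩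
    obtain ⟨hqN, hres⟩ := hprimes q hq hqd
    rw [jacobiSym.mul_left, jacobiSym_conductor_eq_jacobiSym_sign hsq hqN hres]
    exact jacobiSym_mul_self_of_sign hs q
  rw [jacobiSym.mul_left] at hNs
  have hss := jacobiSym_mul_self_of_sign hs d.natAbs
  have hN : J((N : ℤ) | d.natAbs) = J(Int.sign Δ | d.natAbs) := by
    calc J((N : ℤ) | d.natAbs)
        = (J((N : ℤ) | d.natAbs) * J(Int.sign Δ | d.natAbs)) * J(Int.sign Δ | d.natAbs) := by
          rw [mul_assoc, hss, mul_one]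
      _ = J(Int.sign Δ | d.natAbs) := by rw [hNs, one_mul]
  rw [hN]
  rcases lt_or_gt_of_ne hΔ with h | h
  · rw [Int.sign_eq_neg_one_of_neg h, jacobiSym_neg_one_natAbs_eq_sign hd4, if_neg (not_lt.2 h.le)]
    rcases lt_or_gt_of_ne hd0 with h' | h'
    · rw [Int.sign_eq_neg_one_of_neg h']; norm_num
    · rw [Int.sign_eq_one_of_pos h']; norm_num
  · rw [Int.sign_eq_one_of_pos h, jacobiSym.one_left, if_pos h, mul_one]

/-- The sign law as an `iff`: `χ_d(−N) = 1 ↔ h_∞(d) = 0`, i.e. `sign d · J(N | |d|) = 1` iff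
`¬ (Δ > 0 ∧ d < 0)`. [cite: KrizLi2019, Cor. 5.2 ((2) ⟺ (3))] -/
theorem sign_mul_jacobiSym_conductor_eq_one_iff {N : ℕ} {Δ d : ℤ} (hΔ : Δ ≠ 0) (hd4 : d % 4 = 1)
    (hsq : IsSquare ((N : ℤ) * Δ.natAbs))
    (hprimes : ∀ q : ℕ, q.Prime → q ∣ d.natAbs → ¬ (q : ℤ) ∣ (N : ℤ) * Δ ∧ J(Δ | q) = 1) :
    Int.sign d * J((N : ℤ) | d.natAbs) = 1 ↔ ¬ (0 < Δ ∧ d < 0) := by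
  have hd0 : d ≠ 0 := by rintro rfl; norm_num at hd4
  rw [sign_mul_jacobiSym_conductor_eq hΔ hd4 hsq hprimes]
  by_cases hΔp : 0 < Δ
  · rw [if_pos hΔp]
    rcases lt_or_gt_of_ne hd0 with h' | h'
    · rw [Int.sign_eq_neg_one_of_neg h']
      simp [hΔp, h']
    · rw [Int.sign_eq_one_of_pos h']
      simp [not_lt.2 h'.le]
  · rw [if_neg hΔp]
    simp [hΔp]

/-! ## §2 The Heegner side: `χ_D(−N) = −1` in Jacobi currency -/

/-- Per prime `p ∣ N`: `J(p | |D|) = 1` for an odd negative discriminant `D ≡ 1 (mod 4)` in which `p`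
splits (Kronecker form: `D ≡ 1 (mod 8)` if `p = 2`, `J(D | p) = 1` if `p` is odd), by quadratic
reciprocity (`|D| ≡ 3 (mod 4)`) and the values of `χ₄`, `χ₈`. [folklore] -/
theorem jacobiSym_prime_natAbs_eq_one_of_kronecker {D : ℤ} (hD4 : D % 4 = 1) (hD : D < 0)
    {p : ℕ} (hp : p.Prime) (h2 : p = 2 → D % 8 = 1) (hodd : p ≠ 2 → J(D | p) = 1) :
    J((p : ℤ) | D.natAbs) = 1 := by
  have hDodd : Odd D.natAbs := Int.natAbs_odd.2 (Int.odd_iff.2 (by omega))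
  have hD3 : D.natAbs % 4 = 3 := by omega
  by_cases hp2 : p = 2
  · subst hp2
    have h8 : D.natAbs % 8 = 7 := by have := h2 rfl; omega
    rw [show ((2 : ℕ) : ℤ) = 2 by norm_num, jacobiSym.at_two hDodd, ZMod.χ₈_nat_eq_if_mod_eight]
    have h2' : D.natAbs % 2 = 1 := by omega
    simp [h8, h2']
  · have hpodd : Odd p := hp.odd_of_ne_two hp2
    haveI : Fact p.Prime := ⟨hp⟩
    have hDp : J(D | p) = 1 := hodd hp2
    have hnegD : J((D.natAbs : ℤ) | p) = J(-1 | p) := by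
      rw [show (D.natAbs : ℤ) = -1 * D by omega, jacobiSym.mul_left, hDp, mul_one]
    rcases Nat.odd_mod_four_iff.1 (Nat.odd_iff.1 hpodd) with h1 | h3
    · rw [jacobiSym.quadratic_reciprocity_one_mod_four h1 hDodd, hnegD, jacobiSym.at_neg_one hpodd,
        ZMod.χ₄_nat_one_mod_four h1]
    · rw [jacobiSym.quadratic_reciprocity_three_mod_four h3 hD3, hnegD, jacobiSym.at_neg_one hpodd,
        ZMod.χ₄_nat_three_mod_four h3]
      norm_num

/-- **`χ_D(−N) = −1` (Kronecker form of the Heegner hypothesis).** For `N ≥ 1` and an odd negative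
discriminant `D ≡ 1 (mod 4)` such that every prime `p ∣ N` splits in `ℚ(√D)` (`D ≡ 1 (mod 8)` for
`p = 2`, `J(D | p) = 1` for odd `p`): `J(−1 | |D|) · J(N | |D|) = −1`. This is the classical
"`L(E/K, s)` has sign `−1` under the Heegner hypothesis" at the level of characters
(`w(E) w(E^{(D)}) = χ_D(−N) = −1`; Darmon 2004, §3.9 condition (1) with Hyp. 3.9).
[cite: Darmon2004, Hypothesis 3.9 and §3.9 (1)] -/
theorem jacobiSym_neg_one_mul_conductor_eq_neg_one {N : ℕ} (hN : N ≠ 0) {D : ℤ}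
    (hD4 : D % 4 = 1) (hD : D < 0)
    (hK : ∀ p : ℕ, p.Prime → p ∣ N → (p = 2 → D % 8 = 1) ∧ (p ≠ 2 → J(D | p) = 1)) :
    J(-1 | D.natAbs) * J((N : ℤ) | D.natAbs) = -1 := by
  rw [jacobiSym_neg_one_natAbs_eq_sign hD4, Int.sign_eq_neg_one_of_neg hD]
  suffices h : J((N : ℤ) | D.natAbs) = 1 by rw [h]; norm_num
  have hcast : (N : ℤ) = (N.primeFactorsList.map (fun p : ℕ => (p : ℤ))).prod := by
    conv_lhs => rw [← Nat.prod_primeFactorsList hN]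
    rw [Nat.cast_list_prod]
  rw [hcast, jacobiSym.list_prod_left, List.map_map]
  refine List.prod_eq_one (fun x hx => ?_)
  obtain ⟨p, hp, rfl⟩ := List.mem_map.1 hx
  have hpp : p.Prime := Nat.prime_of_mem_primeFactorsList hp
  obtain ⟨h2, hodd⟩ := hK p hpp (Nat.dvd_of_mem_primeFactorsList hp)
  exact jacobiSym_prime_natAbs_eq_one_of_kronecker hD4 hD hpp h2 hodd

/-- The same from the tree's predicate `SatisfiesHeegnerHypothesis N K` for a quadratic field `K`
with ODD negative discriminant `d_K ≡ 1 (mod 4)` (the decomposition law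
`satisfiesHeegnerHypothesis_iff_kronecker`): `J(−1 | |d_K|) · J(N | |d_K|) = −1`.
[cite: Darmon2004, Hypothesis 3.9 and §3.9 (1)] -/
theorem jacobiSym_neg_one_mul_conductor_eq_neg_one_of_heegner {N : ℕ} (hN : N ≠ 0)
    (K : Type*) [Field K] [NumberField K] (h2 : Module.finrank ℚ K = 2)
    (hH : SatisfiesHeegnerHypothesis N K) (hD4 : NumberField.discr K % 4 = 1)
    (hD : NumberField.discr K < 0) :
    J(-1 | (NumberField.discr K).natAbs) * J((N : ℤ) | (NumberField.discr K).natAbs) = -1 :=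
  jacobiSym_neg_one_mul_conductor_eq_neg_one hN hD4 hD
    ((satisfiesHeegnerHypothesis_iff_kronecker N K h2).1 hH)

/-! ## §3 The root number of the member `E^{(d)}` -/

section RootNumbers

variable (W : WeierstrassCurve ℚ) [W.IsElliptic]

/-- **`w(E^{(d)}) = (−1)^{h_∞(d)} · w(E)`** under the sign-law hypotheses (`N · |Δ|` a square; every
prime `q ∣ d` has `q ∤ NΔ` and `J(Δ | q) = 1`; `d ≡ 1 (mod 4)` squarefree, prime to `N`), with
`h_∞(d) = [Δ > 0 ∧ d < 0]`: the twist by `M*` keeps the root number except in the "flip" case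
`Δ > 0`, `M* < 0` (T4-PROOF Remark 4.2/4.2′; Kriz–Li 2019 Cor. 5.2 for their split primes).
[cite: KrizLi2019, Cor. 5.2] [cite: MurtyMurty1997, Ch. 6 §1 (functional equation of L_D(s, f))] -/
theorem rootNumber_twist_eq_hInfty_mul (hmod : exists_isNewformOf) {Δ d : ℤ} (hΔ : Δ ≠ 0)
    (hd4 : d % 4 = 1) (hsqf : Squarefree d) (hgcd : Int.gcd d (W.conductorNorm ℤ) = 1)
    (hsq : IsSquare ((W.conductorNorm ℤ : ℤ) * Δ.natAbs))
    (hprimes : ∀ q : ℕ, q.Prime → q ∣ d.natAbs →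
      ¬ (q : ℤ) ∣ (W.conductorNorm ℤ : ℤ) * Δ ∧ J(Δ | q) = 1) :
    (W.quadraticTwist (d : ℚ)).rootNumber =
      (if 0 < Δ ∧ d < 0 then -1 else 1) * W.rootNumber := by
  have hd0 : d ≠ 0 := by rintro rfl; norm_num at hd4
  obtain ⟨h1, -⟩ := W.rootNumber_quadraticTwist_of_emod_four_eq_one hmod hd4 hsqf hgcd
  rw [h1, jacobiSym_neg_one_natAbs_eq_sign hd4, sign_mul_jacobiSym_conductor_eq hΔ hd4 hsq hprimes]
  congr 1
  by_cases hΔp : 0 < Δ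
  · rw [if_pos hΔp]
    rcases lt_or_gt_of_ne hd0 with h' | h'
    · rw [Int.sign_eq_neg_one_of_neg h', if_pos ⟨hΔp, h'⟩]
    · rw [Int.sign_eq_one_of_pos h', if_neg (fun h => (not_lt.2 h'.le) h.2)]
  · rw [if_neg hΔp, if_neg (fun h => hΔp h.1)]

end RootNumbers

/-! ## §4 The rank table read off the dichotomy -/

/-- Pure bookkeeping: from a dichotomy `{r₁, r₂} = {0, 1}`, `r ≤ 1`, and "`r₁ = r` iff no flip", the
table `r₁ = r`, `r₂ = 1 − r` (no flip) / `r₁ = 1 − r`, `r₂ = r` (flip). [folklore] -/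
theorem rank_table_of_dichotomy {r r₁ r₂ : ℕ} {flip : Prop} (hr : r ≤ 1)
    (hdich : (r₁ = 1 ∧ r₂ = 0) ∨ (r₁ = 0 ∧ r₂ = 1)) (hiff : r₁ = r ↔ ¬ flip) :
    (¬ flip → r₁ = r ∧ r₂ = 1 - r) ∧ (flip → r₁ = 1 - r ∧ r₂ = r) := by
  refine ⟨fun hf => ?_, fun hf => ?_⟩
  · obtain rfl := hiff.2 hf
    rcases hdich with ⟨h1, h2⟩ | ⟨h1, h2⟩ <;> exact ⟨rfl, by omega⟩
  · have h : r₁ ≠ r := fun h => (hiff.1 h) hf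
    rcases hdich with ⟨h1, h2⟩ | ⟨h1, h2⟩ <;> exact ⟨by omega, by omega⟩

/-- **RANK TABLE of the genus pair (route B output, given layer 2).** Let `hdich` be the conclusion of
the genus-point combination in Kriz–Li-Thm-3.3 shape (for the twists `W₁ ≅ E^{(d)}`, `W₂ ≅ E^{(d·d_K)}`:
`{r_an(W₁), r_an(W₂)} = {0, 1}` and `r_an(W₁) = r_an(E) ↔ χ_d(−N) = sign d · J(N | |d|) = 1`), and
assume `r_an(E) ≤ 1` and the sign-law hypotheses on `(N, Δ, d)`. Then with `h_∞ = [Δ > 0 ∧ d < 0]`: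
no flip ⇒ `r_an(W₁) = r_an(E)`, `r_an(W₂) = 1 − r_an(E)`; flip ⇒ `r_an(W₁) = 1 − r_an(E)`,
`r_an(W₂) = r_an(E)`. For `37a1` (`N = Δ = 37 > 0`, `r = 1`) this is the display of Kriz–Li 2019
Example 6.1: rank `E^{(d)} = 1`, `E^{(−7d)} = 0` for `d > 0` and the reverse for `d < 0`.
[cite: KrizLi2019, Thm. 3.3 (arXiv) = Thm. 4.3 (FMS), Cor. 5.2 and Example 6.1] -/
theorem analyticRank_table_of_dichotomy (W W₁ W₂ : WeierstrassCurve ℚ) {Δ d : ℤ} (hΔ : Δ ≠ 0)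
    (hd4 : d % 4 = 1) (hsq : IsSquare ((W.conductorNorm ℤ : ℤ) * Δ.natAbs))
    (hprimes : ∀ q : ℕ, q.Prime → q ∣ d.natAbs →
      ¬ (q : ℤ) ∣ (W.conductorNorm ℤ : ℤ) * Δ ∧ J(Δ | q) = 1)
    (hr : W.analyticRank ≤ 1)
    (hdich : ((W₁.analyticRank = 1 ∧ W₂.analyticRank = 0) ∨
        (W₁.analyticRank = 0 ∧ W₂.analyticRank = 1)) ∧
      (W₁.analyticRank = W.analyticRank ↔
        Int.sign d * J((W.conductorNorm ℤ : ℤ) | d.natAbs) = 1)) :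
    (¬ (0 < Δ ∧ d < 0) →
        W₁.analyticRank = W.analyticRank ∧ W₂.analyticRank = 1 - W.analyticRank) ∧
      ((0 < Δ ∧ d < 0) →
        W₁.analyticRank = 1 - W.analyticRank ∧ W₂.analyticRank = W.analyticRank) :=
  rank_table_of_dichotomy hr hdich.1
    (hdich.2.trans (sign_mul_jacobiSym_conductor_eq_one_iff hΔ hd4 hsq hprimes))

/-! ## §5 Binding `Δ := Δ_min` and discharging `hsq` from `Tam(E)` odd (referee F8-1) -/

section Minimal

variable (W : WeierstrassCurve ℚ) [W.IsElliptic] [W.IsGloballyMinimal]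

/-- **`hsq` DISCHARGED on class (H-c): `Tam(E)` odd ⇒ `N_E · |Δ_min|` is a square**, with `Δ` bound to
the minimal discriminant `minimalDiscriminantInt W` of the globally minimal model — the tree's
Tamagawa-parity square lemma (`isSquare_conductorNorm_mul_minimalDiscriminantNorm`, cell b2b O1, from
the discharged Tate table `c_v` odd ⇒ `m_v` odd and Ogg's formula) read in this file's currency.
[cite: SilvermanATAEC1994, IV.9.4 Table 4.1 and IV.11.1] -/
theorem isSquare_conductorNorm_mul_natAbs_minimalDiscriminantInt (hodd : Odd W.tamagawaProduct) :
    IsSquare ((W.conductorNorm ℤ : ℤ) * (minimalDiscriminantInt W).natAbs) := by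
  obtain ⟨k, hk⟩ :=
    Summit.BirchSwinnertonDyer.Rank1Residual.Supersingular.isSquare_conductorNorm_mul_minimalDiscriminantNorm
      W hodd
  refine ⟨(k : ℤ), ?_⟩
  rw [← W.minimalDiscriminantNorm_int_eq_natAbs_minimalDiscriminantInt_holds]
  exact_mod_cast hk

/-- **SIGN LAW on the class `E(ℚ)`-minimal model, `Tam(E)` odd** (F8-1 form): for a globally minimal
elliptic `W/ℚ` with `∏ c_ℓ` odd and `d ≡ 1 (mod 4)` all of whose prime factors `q` satisfy
`q ∤ N_E·Δ_min` and `J(Δ_min | q) = 1` (the resolvent hypothesis, `a_q` odd), `χ_d(−N_E) = sign d · J(N_E | |d|)`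
equals `sign d` if `Δ_min > 0` and `1` if `Δ_min < 0`. [cite: KrizLi2019, Cor. 5.2 ((2) ⟺ (3))]
[cite: SilvermanATAEC1994, IV.9.4 Table 4.1 and IV.11.1] -/
theorem sign_mul_jacobiSym_conductor_eq_of_odd_tamagawaProduct (hodd : Odd W.tamagawaProduct)
    {d : ℤ} (hd4 : d % 4 = 1)
    (hprimes : ∀ q : ℕ, q.Prime → q ∣ d.natAbs →
      ¬ (q : ℤ) ∣ (W.conductorNorm ℤ : ℤ) * minimalDiscriminantInt W ∧
        J(minimalDiscriminantInt W | q) = 1) :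
    Int.sign d * J((W.conductorNorm ℤ : ℤ) | d.natAbs) =
      if 0 < minimalDiscriminantInt W then Int.sign d else 1 :=
  sign_mul_jacobiSym_conductor_eq (minimalDiscriminantInt_ne_zero W) hd4
    (isSquare_conductorNorm_mul_natAbs_minimalDiscriminantInt W hodd) hprimes

/-- **`w(E^{(d)}) = (−1)^{h_∞(d)} w(E)` on the class `Tam(E)` odd** (F8-1 form of
`rootNumber_twist_eq_hInfty_mul`, `Δ := Δ_min`, `h_∞(d) = [Δ_min > 0 ∧ d < 0]`).
[cite: KrizLi2019, Cor. 5.2] [cite: MurtyMurty1997, Ch. 6 §1 (functional equation of L_D(s, f))] -/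
theorem rootNumber_twist_eq_hInfty_mul_of_odd_tamagawaProduct (hmod : exists_isNewformOf)
    (hodd : Odd W.tamagawaProduct) {d : ℤ} (hd4 : d % 4 = 1) (hsqf : Squarefree d)
    (hgcd : Int.gcd d (W.conductorNorm ℤ) = 1)
    (hprimes : ∀ q : ℕ, q.Prime → q ∣ d.natAbs →
      ¬ (q : ℤ) ∣ (W.conductorNorm ℤ : ℤ) * minimalDiscriminantInt W ∧
        J(minimalDiscriminantInt W | q) = 1) :
    (W.quadraticTwist (d : ℚ)).rootNumber =
      (if 0 < minimalDiscriminantInt W ∧ d < 0 then -1 else 1) * W.rootNumber :=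
  rootNumber_twist_eq_hInfty_mul W hmod (minimalDiscriminantInt_ne_zero W) hd4 hsqf hgcd
    (isSquare_conductorNorm_mul_natAbs_minimalDiscriminantInt W hodd) hprimes

end Minimal

end Summit.BirchSwinnertonDyer.Uniform.U2

end
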